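import Literature.Analysis.FluidPDE.ForwardDSSMollifiedScheme
import Literature.Analysis.FluidPDE.MollifiedField
import Mathlib.Analysis.Distribution.AEEqOfIntegralContDiff
import HarnessLib

/-!
# Forward DSS solutions: the local energy equality (3.7) for the mollified approximants

Analysis/FluidPDE proof file (theorems only) under the named fact
`Literature.Analysis.FluidPDE.bradshawTsai2019_apriori_3_12` (`ForwardDSSMollifiedScheme.lean`:
the a priori estimate (3.12) of Bradshaw–Tsai, Analysis & PDE 12 (2019) = arXiv:1801.08060,
§3, for every member of the class `BradshawTsai2019.IsMollifiedApproximant`). The printed proof of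
(3.12) starts from

> "Note that `v_ε` satisfies the local energy equality, i.e.,
> (3.7) `∫|v_ε|²φ(t) dx + 2∫₀ᵗ∫|∇v_ε|²φ dx ds = ∫|v₀|²φ dx + ∫₀ᵗ∫|v_ε|²(∂ₛφ + Δφ) dx ds
>  + ∫₀ᵗ∫|v_ε|²((η_{ε√s} * v_ε)·∇φ) dx ds + ∫₀ᵗ∫ 2π_ε(v_ε·∇φ) dx ds`
> for any non-negative `φ ∈ C₀^∞(ℝ³ × [0,∞))`." (p. 8)

The class records the mollified system (3.5) in the sense of distributions on the open slab
`(0,∞) × ℝ³` (the velocity being smooth there, the pressure merely locally integrable). This file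
**proves** the local energy equality in its distributional (test-function) form on the open slab,
for every member of the class and every space–time test function `φ` (no sign condition):

  `2 ∫∫ φ |∇v_ε|² = ∫∫ |v_ε|² (∂ₜφ + Δφ) + ∫∫ |v_ε|² ⟪η_{ε√t} * v_ε, ∇φ⟫ + ∫∫ 2 π_ε ⟪v_ε, ∇φ⟫`

(`IsMollifiedApproximant.local_energy_eq`), i.e. (3.7) for `φ` compactly supported in
`(0,∞) × ℝ³` (the time-boundary terms of (3.7) then vanish); the sliced form with the terms
`∫|v_ε|²φ(t) dx`, `∫|v₀|²φ dx` is the limit of this identity along time cut-offs and is left to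
the discharge of (3.12). On the way the file proves the regularity facts about members used by
every estimate of pp. 8–10: the velocity is classically divergence free on the slab
(`divergence_eq_zero`), the drift `η_{ε√t} * v_ε` is jointly continuous on the slab, smooth and
divergence free on each slice (`continuousOn_mollifiedDrift`, `contDiff_mollifiedDrift_slice`,
`divergence_mollifiedDrift_slice`), through the substitution
`(η_{ε√t} * w(t))(x) = ∫ η(u) w(t, x − ε√t u) du` (`mollifiedDrift_eq_integral_smul`).

## Proof

As for smooth solutions (Caffarelli–Kohn–Nirenberg 1982, §2, "(2.5) holds with equality"; the
tree's `local_energy_eq_of_contDiffOn`, `ClassicalSuitable`, whose bookkeeping is followed), but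
with the pressure kept distributional: test (3.5) against the admissible field `ψ = φ v_ε`
(`isSpaceTimeTestOn_smul_of_contDiffOn`). The pressure term is `∫∫ π_ε div(φv_ε) = ∫∫ π_ε ⟪v_ε, ∇φ⟫`
since `div v_ε = 0`; the time term is `∫∫ ⟪v_ε, ∂ₜ(φv_ε)⟫ = ½∫∫ |v_ε|² ∂ₜφ` (pairing in time,
`integral_integral_eq_zero_of_hasDerivAt_time`); at each time, Green's identity gives
`∫ ⟪v, Δ(φv)⟫ = ½∫ Δφ |v|² − ∫ φ |∇v|²` (`integral_inner_laplacian_smul_self`) and the trilinear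
convection identity with the divergence-free drift `b` gives `∫ ⟪v, (b·∇)(φv)⟫ = ½∫ |v|² ⟪b, ∇φ⟫`
(`integral_inner_convect_smul_self`); Fubini for continuous compactly supported integrands
(`setIntegral_eq_integral_integral_of_continuousOn`) moves between the slab and the slices.

## References

* Z. Bradshaw, T.-P. Tsai, Analysis & PDE 12 (2019) = arXiv:1801.08060, §3, (3.5), (3.7) (p. 8)
  [BradshawTsai2019].
* L. Caffarelli, R. Kohn, L. Nirenberg, CPAM 35 (1982), §2, (2.5) [CaffarelliKohnNirenberg1982].
-/

noncomputable section

open MeasureTheory Set Function Filter Topology TopologicalSpace Metric Module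
open scoped NNReal ENNReal RealInnerProductSpace ContDiff Laplacian Convolution

namespace Literature.Analysis.FluidPDE

/-! ## Calculus on one time slice -/

section Slice

variable {E : Type*} [NormedAddCommGroup E] [InnerProductSpace ℝ E] [FiniteDimensional ℝ E]
  [MeasurableSpace E] [BorelSpace E]

/-- **Green's identity against `φ V`.** For `V ∈ C²(E; E)` and `φ ∈ C²_c(E)`,
`∫ ⟪V, Δ(φV)⟫ = ½ ∫ Δφ |V|² − ∫ φ |∇V|²` (`|∇V|²` the Frobenius norm): Green's first identity
without boundary for `⟪Δ(φV), V⟫`, the Leibniz rule `∂ᵢ(φV) = ∂ᵢφ V + φ ∂ᵢV`, and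
`Σᵢ ∫ ∂ᵢφ ⟪∂ᵢV, V⟫ = −½∫ Δφ |V|²` (Caffarelli–Kohn–Nirenberg 1982, §2, the viscous terms of
(2.5) for smooth solutions). [cite: CaffarelliKohnNirenberg1982, §2 (2.5)] -/
theorem integral_inner_laplacian_smul_self {V : E → E} {φ : E → ℝ} (hV : ContDiff ℝ 2 V)
    (hφ : ContDiff ℝ 2 φ) (hφc : HasCompactSupport φ) :
    ∫ x, ⟪V x, (Δ (fun y => φ y • V y)) x⟫ =
      2⁻¹ * (∫ x, (Δ φ) x * ‖V x‖ ^ 2) - ∫ x, φ x * frobeniusNormSq (fderiv ℝ V x) := by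
  set e := stdOrthonormalBasis ℝ E with he
  have hV1 : ContDiff ℝ 1 V := hV.of_le one_le_two
  have hφ1 : ContDiff ℝ 1 φ := hφ.of_le one_le_two
  have hψ : ContDiff ℝ 2 fun y => φ y • V y := hφ.smul hV
  have hψc : HasCompactSupport fun y => φ y • V y := hφc.smul_right
  have hdV : ∀ x, DifferentiableAt ℝ V x := fun x => hV1.differentiable one_ne_zero x
  have hdφ : ∀ x, DifferentiableAt ℝ φ x := fun x => hφ1.differentiable one_ne_zero x
  -- Green: `∫ ⟪Δ(φV), V⟫ + Σᵢ ∫ ⟪∂ᵢ(φV), ∂ᵢV⟫ = 0`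
  have green := integral_inner_laplacian_add_eq_zero e hψ hV1 (Or.inl hψc)
  -- the Leibniz rule on the partial derivatives
  have hD : ∀ x i, fderiv ℝ (fun y => φ y • V y) x (e i) =
      φ x • fderiv ℝ V x (e i) + fderiv ℝ φ x (e i) • V x := fun x i => by
    rw [fderiv_fun_smul (hdφ x) (hdV x)]
    simp [add_comm]
  have hsum : ∀ i, ∫ x, ⟪fderiv ℝ (fun y => φ y • V y) x (e i), fderiv ℝ V x (e i)⟫ =
      (∫ x, φ x * ‖fderiv ℝ V x (e i)‖ ^ 2) +
        ∫ x, fderiv ℝ φ x (e i) * ⟪fderiv ℝ V x (e i), V x⟫ := by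
    intro i
    have i1 : Integrable (fun x => φ x * ‖fderiv ℝ V x (e i)‖ ^ 2) (volume : Measure E) :=
      (hφ.continuous.mul (((hV1.continuous_fderiv one_ne_zero).clm_apply
        continuous_const).norm.pow 2)).integrable_of_hasCompactSupport hφc.mul_right
    have i2 : Integrable (fun x => fderiv ℝ φ x (e i) * ⟪fderiv ℝ V x (e i), V x⟫)
        (volume : Measure E) :=
      (((hφ1.continuous_fderiv one_ne_zero).clm_apply continuous_const).mul
        (((hV1.continuous_fderiv one_ne_zero).clm_apply continuous_const).inner
          hV.continuous)).integrable_of_hasCompactSupport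
        ((hφc.fderiv_apply (𝕜 := ℝ) (e i)).mul_right)
    rw [← integral_add i1 i2]
    refine integral_congr_ae (Eventually.of_forall fun x => ?_)
    dsimp only
    rw [hD, inner_add_left, real_inner_smul_left, real_inner_smul_left,
      real_inner_self_eq_norm_sq, real_inner_comm]
  have hfrob : ∀ x, frobeniusNormSq (fderiv ℝ V x) = ∑ i, ‖fderiv ℝ V x (e i)‖ ^ 2 := fun x => rfl
  have i3 : ∀ i, Integrable (fun x => φ x * ‖fderiv ℝ V x (e i)‖ ^ 2) (volume : Measure E) :=
    fun i => (hφ.continuous.mul (((hV1.continuous_fderiv one_ne_zero).clm_apply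
      continuous_const).norm.pow 2)).integrable_of_hasCompactSupport hφc.mul_right
  have hdiss : ∫ x, φ x * frobeniusNormSq (fderiv ℝ V x) =
      ∑ i, ∫ x, φ x * ‖fderiv ℝ V x (e i)‖ ^ 2 := by
    rw [← integral_finsetSum _ fun i _ => i3 i]
    refine integral_congr_ae (Eventually.of_forall fun x => ?_)
    dsimp only
    rw [hfrob, Finset.mul_sum]
  have hcomm : ∫ x, ⟪V x, (Δ (fun y => φ y • V y)) x⟫ =
      ∫ x, ⟪(Δ (fun y => φ y • V y)) x, V x⟫ :=
    integral_congr_ae (Eventually.of_forall fun x => real_inner_comm _ _)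
  have hvisc := sum_integral_fderiv_mul_inner_fderiv_eq hφ hφc hV1
  simp_rw [hsum] at green
  rw [Finset.sum_add_distrib, ← hdiss, hvisc] at green
  rw [hcomm]
  linarith

/-- **The transport term with a divergence-free drift.** For `V, B ∈ C¹(E; E)` with
`div B = 0` and `φ ∈ C¹_c(E)`, `∫ ⟪V, (B·∇)(φV)⟫ = ½ ∫ |V|² ⟪B, ∇φ⟫`: the trilinear identity
`∫ ⟪(B·∇)V, φV⟫ + ∫ ⟪V, (B·∇)(φV)⟫ = 0` and `2∫ φ ⟪DV(B), V⟫ = −∫ |V|² ⟪B, ∇φ⟫`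
(`∫ |V|² div(φB) + ∫ ⟪φB, ∇|V|²⟫ = 0`, `div(φB) = ⟪B, ∇φ⟫`) — the passage from
`(b·∇)(|v|²/2)` to `(|v|²/2) b·∇φ` in the local energy balance (Caffarelli–Kohn–Nirenberg 1982,
§2, (2.5); Bradshaw–Tsai 2019, (3.7), the term `∫∫|v_ε|²((η_{ε√s} * v_ε)·∇φ)`). [cite: BradshawTsai2019, (3.7)] -/
theorem integral_inner_convect_smul_self {V B : E → E} {φ : E → ℝ} (hV : ContDiff ℝ 1 V)
    (hB : ContDiff ℝ 1 B) (hdiv : ∀ x, VectorCalculus.divergence B x = 0) (hφ : ContDiff ℝ 1 φ)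
    (hφc : HasCompactSupport φ) :
    ∫ x, ⟪V x, convect B (fun y => φ y • V y) x⟫ = 2⁻¹ * ∫ x, ‖V x‖ ^ 2 * ⟪B x, gradient φ x⟫ := by
  have hdV : ∀ x, DifferentiableAt ℝ V x := fun x => hV.differentiable one_ne_zero x
  have hdφ : ∀ x, DifferentiableAt ℝ φ x := fun x => hφ.differentiable one_ne_zero x
  have hdB : ∀ x, DifferentiableAt ℝ B x := fun x => hB.differentiable one_ne_zero x
  -- the trilinear identity
  have tri := integral_inner_convect_add_eq_zero (u := B) (v := V) (w := fun y => φ y • V y) hB hV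
    (hφ.smul hV) hφc.smul_right
  have h3 : ∫ x, VectorCalculus.divergence B x * ⟪V x, φ x • V x⟫ = 0 :=
    integral_eq_zero_of_ae (Eventually.of_forall fun x => by simp [hdiv x])
  have h1 : ∫ x, ⟪convect B V x, φ x • V x⟫ = ∫ x, φ x * ⟪fderiv ℝ V x (B x), V x⟫ :=
    integral_congr_ae (Eventually.of_forall fun x => by
      simp only [convect, real_inner_smul_right])
  rw [h3, add_zero, h1] at tri
  -- the transport identity `∫ |V|² div(φB) + ∫ ⟪φB, ∇|V|²⟫ = 0`
  have trans := integral_mul_divergence_add_eq_zero_right (θ := fun y => ‖V y‖ ^ 2)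
    (u := fun y => φ y • B y) (hV.norm_sq ℝ) (hφ.smul hB) hφc.smul_right
  have hl : ∀ x, ‖V x‖ ^ 2 * VectorCalculus.divergence (fun y => φ y • B y) x =
      ‖V x‖ ^ 2 * ⟪B x, gradient φ x⟫ := fun x => by
    rw [divergence_smul_apply (hdφ x) (hdB x), hdiv x, mul_zero, zero_add]
  have hnsq : ∀ x (h : E), fderiv ℝ (fun y => ‖V y‖ ^ 2) x h = 2 * ⟪V x, fderiv ℝ V x h⟫ :=
    fun x h => by
    rw [(hdV x).hasFDerivAt.norm_sq.fderiv]
    simp [innerSL_apply_apply, two_smul]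
    ring
  have hr : ∀ x, ⟪φ x • B x, gradient (fun y => ‖V y‖ ^ 2) x⟫ =
      2 * (φ x * ⟪fderiv ℝ V x (B x), V x⟫) := fun x => by
    rw [← fderiv_apply_eq_inner_gradient, map_smul, hnsq, smul_eq_mul, real_inner_comm]
    ring
  rw [integral_congr_ae (Eventually.of_forall hl), integral_congr_ae (Eventually.of_forall hr),
    integral_const_mul] at trans
  linarith

end Slice

/-! ## Test fields: multiplying a test function by a smooth field -/

section TestField

variable {E : Type*} [NormedAddCommGroup E] [NormedSpace ℝ E]
variable {F : Type*} [NormedAddCommGroup F] [NormedSpace ℝ F]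

/-- **`φ w` is a test field** when `φ` is a scalar space–time test function on `Q` and `w` is
jointly smooth on an open set `U ⊇ Q` (the admissible test `ψ = φ u` of the derivation of the
local energy balance, Caffarelli–Kohn–Nirenberg 1982, §2): smooth at points of `U` by the product
rule and near the other points because `φ` vanishes identically there. [folklore] -/
theorem isSpaceTimeTestOn_smul_of_contDiffOn {Q : Opens (ℝ × E)} {U : Set (ℝ × E)}
    (hU : IsOpen U) (hQU : (Q : Set (ℝ × E)) ⊆ U) {φ : ℝ → E → ℝ} (hφ : IsSpaceTimeTestOn Q φ)
    {w : ℝ → E → F} (hw : ContDiffOn ℝ ∞ (uncurry w) U) :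
    IsSpaceTimeTestOn Q fun t x => φ t x • w t x := by
  have heq : uncurry (fun t x => φ t x • w t x) = fun z => uncurry φ z • uncurry w z := rfl
  refine ⟨?_, ?_, ?_⟩
  · rw [heq]
    refine contDiff_iff_contDiffAt.2 fun z => ?_
    by_cases hz : z ∈ U
    · exact hφ.contDiff.contDiffAt.smul (hw.contDiffAt (hU.mem_nhds hz))
    · have hz' : z ∉ tsupport (uncurry φ) := fun h => hz (hQU (hφ.tsupport_subset h))
      have hev : (fun z => uncurry φ z • uncurry w z) =ᶠ[𝓝 z] fun _ => 0 := by
        filter_upwards [(isClosed_tsupport _).isOpen_compl.mem_nhds hz'] with y hy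
        rw [image_eq_zero_of_notMem_tsupport hy, zero_smul]
      exact (contDiffAt_const (c := (0 : F))).congr_of_eventuallyEq hev
  · rw [heq]; exact hφ.hasCompactSupport.smul_right
  · rw [heq]; exact (tsupport_smul_subset_left _ _).trans hφ.tsupport_subset

end TestField

namespace BradshawTsai2019

/-! ## The drift on the slab: substitution, joint continuity, smooth divergence-free slices -/

section Drift

variable {E : Type*} [NormedAddCommGroup E] [InnerProductSpace ℝ E] [FiniteDimensional ℝ E]
  [MeasurableSpace E] [BorelSpace E]
variable {F : Type*} [NormedAddCommGroup F] [NormedSpace ℝ F]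

/-- **The substitution `y = ε√t u`**: for `ε√t > 0`,
`(η_{ε√t} * w(t))(x) = ∫ η(u) w(t, x − ε√t u) du` (Bradshaw–Tsai 2019, p. 9, "after
re-scaling"). [cite: BradshawTsai2019, §3 (3.9)] -/
theorem mollifiedDrift_eq_integral_smul (η : E → ℝ) {ε t : ℝ} (hδ : 0 < ε * Real.sqrt t)
    (w : ℝ → E → F) (x : E) :
    mollifiedDrift η ε w t x = ∫ u, η u • w t (x - (ε * Real.sqrt t) • u) := by
  set δ : ℝ := ε * Real.sqrt t with hδdef
  have hδ0 : δ ≠ 0 := hδ.ne'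
  have hδn : (δ ^ finrank ℝ E) ≠ 0 := pow_ne_zero _ hδ0
  set G : E → F := fun u => (δ ^ finrank ℝ E)⁻¹ • (η u • w t (x - δ • u)) with hG
  have hpt : ∀ y, scaledMollifier η δ y • w t (x - y) = G (δ⁻¹ • y) := fun y => by
    simp only [hG, scaledMollifier_apply, smul_inv_smul₀ hδ0, smul_smul]
  rw [mollifiedDrift_apply, ← hδdef]
  simp_rw [hpt]
  rw [Measure.integral_comp_inv_smul_of_nonneg volume G hδ.le, hG, integral_smul, smul_smul,
    mul_inv_cancel₀ hδn, one_smul]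

/-- **Joint continuity of the drift on the slab.** If `η` is continuous with compact support,
`ε > 0` and `w` is jointly continuous on `(0,∞) × E`, then so is `η_{ε√t} * w(t)` (the
substituted form is a parametric integral over the compact `supp η` of a jointly continuous
integrand). [folklore] -/
theorem continuousOn_mollifiedDrift {η : E → ℝ} (hη : Continuous η) (hηc : HasCompactSupport η)
    {ε : ℝ} (hε : 0 < ε) {w : ℝ → E → F}
    (hw : ContinuousOn (uncurry w) (Ioi (0 : ℝ) ×ˢ (univ : Set E))) :
    ContinuousOn (uncurry (mollifiedDrift η ε w)) (Ioi (0 : ℝ) ×ˢ (univ : Set E)) := by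
  set s : Set (ℝ × E) := Ioi (0 : ℝ) ×ˢ (univ : Set E) with hs
  set f : ℝ × E → E → F := fun z u => η u • w z.1 (z.2 - (ε * Real.sqrt z.1) • u) with hf
  -- the substituted integrand is jointly continuous on `s × E` and vanishes off `supp η`
  have hmap : ContinuousOn (fun p : (ℝ × E) × E => (p.1.1, p.1.2 - (ε * Real.sqrt p.1.1) • p.2))
      (s ×ˢ univ) := by fun_prop
  have hmaps : MapsTo (fun p : (ℝ × E) × E => (p.1.1, p.1.2 - (ε * Real.sqrt p.1.1) • p.2))
      (s ×ˢ univ) s := fun p hp => ⟨hp.1.1, mem_univ _⟩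
  have hfc : ContinuousOn (uncurry f) (s ×ˢ univ) :=
    ((hη.comp continuous_snd).continuousOn).smul (hw.comp hmap hmaps)
  have hfs : ∀ p u, p ∈ s → u ∉ tsupport η → f p u = 0 := fun p u _ hu => by
    simp only [hf, image_eq_zero_of_notMem_tsupport hu, zero_smul]
  have hg : IntegrableOn (fun _ : E => (1 : ℝ)) (tsupport η) volume :=
    integrableOn_const hηc.measure_lt_top.ne
  have hcont := continuousOn_integral_bilinear_of_locally_integrable_of_compact_support
    (ContinuousLinearMap.lsmul ℝ ℝ : ℝ →L[ℝ] F →L[ℝ] F) hηc hfc hfs hg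
  simp only [ContinuousLinearMap.lsmul_apply, one_smul] at hcont
  refine hcont.congr fun z hz => ?_
  have hz1 : 0 < z.1 := hz.1
  exact mollifiedDrift_eq_integral_smul η (mul_pos hε (Real.sqrt_pos.2 hz1)) w z.2

omit [MeasurableSpace E] [BorelSpace E] [FiniteDimensional ℝ E] in
/-- The scaled mollifier `η_δ` of a compactly supported `η` is compactly supported (`δ ≠ 0`). [folklore] -/
theorem hasCompactSupport_scaledMollifier_of_ne_zero {η : E → ℝ} (hηc : HasCompactSupport η)
    {δ : ℝ} (hδ : δ ≠ 0) : HasCompactSupport (scaledMollifier η δ) :=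
  ((hηc.comp_smul (inv_ne_zero hδ)).mul_left :
    HasCompactSupport fun y => (δ ^ finrank ℝ E)⁻¹ * η (δ⁻¹ • y))

omit [MeasurableSpace E] [BorelSpace E] [FiniteDimensional ℝ E] in
/-- The scaled mollifier `η_δ` of a smooth `η` is smooth. [folklore] -/
theorem contDiff_scaledMollifier {η : E → ℝ} (hη : ContDiff ℝ ∞ η) (δ : ℝ) :
    ContDiff ℝ ∞ (scaledMollifier η δ) :=
  (contDiff_const.mul (hη.comp (contDiff_const_smul δ⁻¹)) :
    ContDiff ℝ ∞ fun y => (δ ^ finrank ℝ E)⁻¹ * η (δ⁻¹ • y))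

/-- **The drift is smooth on each slice**: `η_{ε√t} * w(t) ∈ C^∞(E)` for `ε√t ≠ 0` and a
locally integrable slice `w(t)` (convolution with a `C_c^∞` kernel). [folklore] -/
theorem contDiff_mollifiedDrift_slice {η : E → ℝ} (hη : ContDiff ℝ ∞ η)
    (hηc : HasCompactSupport η) {ε t : ℝ} (hδ : ε * Real.sqrt t ≠ 0) {w : ℝ → E → F}
    (hwt : LocallyIntegrable (w t) volume) : ContDiff ℝ ∞ (mollifiedDrift η ε w t) :=
  ((hasCompactSupport_scaledMollifier_of_ne_zero hηc hδ).contDiff_convolution_left _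
    (contDiff_scaledMollifier hη _) hwt : ContDiff ℝ ∞
      (scaledMollifier η (ε * Real.sqrt t) ⋆[ContinuousLinearMap.lsmul ℝ ℝ, volume] w t))

/-- **The drift is divergence free on each slice** when the slice `w(t)` is weakly divergence
free (`div (ρ ⋆ w) = ρ ⋆ div w = 0`, the accepted `divergence_convolution_eq_zero`; Bradshaw–Tsai
2019 use `div(η_{ε√t} * v_ε) = 0` tacitly in (3.7)). [cite: BradshawTsai2019, (3.7)] -/
theorem divergence_mollifiedDrift_slice {η : E → ℝ} (hη : ContDiff ℝ ∞ η)
    (hηc : HasCompactSupport η) {ε t : ℝ} (hδ : ε * Real.sqrt t ≠ 0) {w : ℝ → E → E}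
    (hwt : LocallyIntegrable (w t) volume) (hdiv : IsWeaklyDivFree (w t)) (x : E) :
    VectorCalculus.divergence (mollifiedDrift η ε w t) x = 0 :=
  (divergence_convolution_eq_zero (contDiff_scaledMollifier hη _)
    (hasCompactSupport_scaledMollifier_of_ne_zero hηc hδ) hwt hdiv x :
      VectorCalculus.divergence
        (scaledMollifier η (ε * Real.sqrt t) ⋆[ContinuousLinearMap.lsmul ℝ ℝ, volume] w t) x = 0)

end Drift

/-! ## Space–time bookkeeping on the slab -/

section Slab

variable {E : Type*} [NormedAddCommGroup E] [InnerProductSpace ℝ E] [FiniteDimensional ℝ E]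
  [MeasurableSpace E] [BorelSpace E]

/-- **Continuous compactly supported integrands on the slab.** If `F` is continuous on the open
slab `(0,∞) × E` and vanishes off a compact `K` inside it, then every slice `F(s, ·)` is
integrable, `s ↦ ∫ F(s, ·)` is integrable, `F` is integrable on the slab, and its integral over
the slab is the iterated integral (Fubini for a continuous compactly supported integrand; the
bookkeeping of `ClassicalSuitable`). [folklore] -/
theorem slab_integrable_of_continuousOn {K : Set (ℝ × E)} (hK : IsCompact K)
    (hKQ : K ⊆ Ioi (0 : ℝ) ×ˢ (univ : Set E)) {F : ℝ × E → ℝ}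
    (hF : ContinuousOn F (Ioi (0 : ℝ) ×ˢ (univ : Set E))) (hF0 : ∀ z ∉ K, F z = 0) :
    (∀ s, Integrable (fun x => F (s, x)) (volume : Measure E)) ∧
      Integrable (fun s => ∫ x, F (s, x)) (volume : Measure ℝ) ∧
      IntegrableOn F (Ioi (0 : ℝ) ×ˢ (univ : Set E)) volume ∧
      ∫ z in Ioi (0 : ℝ) ×ˢ (univ : Set E), F z = ∫ s, ∫ x, F (s, x) := by
  have hc : Continuous F :=
    continuous_of_continuousOn_of_eq_zero (isOpen_Ioi.prod isOpen_univ) hK.isClosed hKQ hF hF0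
  have hI : Integrable F ((volume : Measure ℝ).prod (volume : Measure E)) :=
    hc.integrable_of_hasCompactSupport (HasCompactSupport.intro hK hF0)
  have hKx : IsCompact (Prod.snd '' K) := hK.image continuous_snd
  refine ⟨fun s => ?_, hI.integral_prod_left, hI.integrableOn,
    setIntegral_eq_integral_integral_of_continuousOn isOpen_Ioi hK hKQ subset_rfl hF hF0⟩
  exact (hc.comp (Continuous.prodMk_right s)).integrable_of_hasCompactSupport
    (HasCompactSupport.intro hKx fun x hx => hF0 _ fun h => hx ⟨(s, x), h, rfl⟩)

end Slab

/-! ## Members of the class: divergence, drift, and the local energy equality -/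

section LocalEnergy

variable {c ε : ℝ} {η : EuclideanSpace ℝ (Fin 3) → ℝ}
  {v₀ : EuclideanSpace ℝ (Fin 3) → EuclideanSpace ℝ (Fin 3)}
  {w : ℝ → EuclideanSpace ℝ (Fin 3) → EuclideanSpace ℝ (Fin 3)} {ϖ : ℝ → EuclideanSpace ℝ (Fin 3) → ℝ}

/-- The slices `v_ε(t)`, `t > 0`, of a mollified approximant are smooth. [folklore] -/
theorem IsMollifiedApproximant.contDiff_slice (h : IsMollifiedApproximant c ε η v₀ w ϖ) {t : ℝ}
    (ht : 0 < t) : ContDiff ℝ ∞ (w t) :=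
  contDiff_slice_of_contDiffOn h.smooth ht

/-- **A mollified approximant is classically divergence free on the slab**: `div v_ε(t) = 0`
on `ℝ³` for every `t > 0`. The weak identity `∫∫ ⟪v_ε, ∇θ⟫ = 0` of the class and an
integration by parts on each slice give `∫∫ θ div v_ε = 0` for all tests `θ` on the slab, so
`div v_ε = 0` a.e. there (Mathlib's `IsOpen.ae_eq_zero_of_integral_contDiff_smul_eq_zero`),
hence everywhere by continuity. [cite: BradshawTsai2019, (3.5)] -/
theorem IsMollifiedApproximant.divergence_eq_zero (h : IsMollifiedApproximant c ε η v₀ w ϖ)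
    {t : ℝ} (ht : 0 < t) (x : (EuclideanSpace ℝ (Fin 3))) : VectorCalculus.divergence (w t) x = 0 := by
  set U : Set (ℝ × EuclideanSpace ℝ (Fin 3)) := Ioi (0 : ℝ) ×ˢ (univ : Set (EuclideanSpace ℝ (Fin 3))) with hU_def
  have hU : IsOpen U := isOpen_Ioi.prod isOpen_univ
  have hw1 : ContDiffOn ℝ 1 (uncurry w) U := h.smooth.of_le (by exact_mod_cast le_top)
  have cw : ContinuousOn (fun z : ℝ × EuclideanSpace ℝ (Fin 3) => w z.1 z.2) U := h.smooth.continuousOn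
  have cDw : ContinuousOn (fun z : ℝ × EuclideanSpace ℝ (Fin 3) => fderiv ℝ (w z.1) z.2) U :=
    continuousOn_fderiv_slice_of_contDiffOn hw1 isOpen_Ioi.uniqueDiffOn
  -- the divergence as a function on space–time, continuous on `U`
  set d : ℝ × EuclideanSpace ℝ (Fin 3) → ℝ := fun z => VectorCalculus.divergence (w z.1) z.2 with hd_def
  have cd : ContinuousOn d U := by
    have hsum : d = fun z => ∑ i, ⟪stdOrthonormalBasis ℝ (EuclideanSpace ℝ (Fin 3)) i,
        fderiv ℝ (w z.1) z.2 (stdOrthonormalBasis ℝ (EuclideanSpace ℝ (Fin 3)) i)⟫ :=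
      funext fun z => divergence_eq_sum_inner_fderiv (stdOrthonormalBasis ℝ (EuclideanSpace ℝ (Fin 3))) _ _
    rw [hsum]
    exact continuousOn_finsetSum _ fun i _ =>
      continuousOn_const.inner (cDw.clm_apply continuousOn_const)
  -- `div w = 0` almost everywhere on `U`
  have hae : ∀ᵐ z ∂(volume : Measure (ℝ × EuclideanSpace ℝ (Fin 3))), z ∈ U → d z = 0 := by
    refine hU.ae_eq_zero_of_integral_contDiff_smul_eq_zero
      (cd.locallyIntegrableOn hU.measurableSet) fun g hg hgc hgU => ?_
    -- `θ = curry g` is a test function on the slab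
    have hθ : IsSpaceTimeTestOn (slab (EuclideanSpace ℝ (Fin 3)) (Ioi 0) isOpen_Ioi) (curry g) :=
      ⟨hg, hgc, by rw [coe_slab]; exact hgU⟩
    have h0 := h.divFree (curry g) hθ
    set K : Set (ℝ × EuclideanSpace ℝ (Fin 3)) := tsupport g with hK_def
    have hK : IsCompact K := hgc
    have hKU : K ⊆ U := hgU
    have hg0 : ∀ z ∉ K, g z = 0 := fun z hz => image_eq_zero_of_notMem_tsupport hz
    have hgr0 : ∀ z ∉ K, gradient (curry g z.1) z.2 = 0 := fun z hz =>
      gradient_eq_zero_of_notMem_tsupport (notMem_tsupport_slice_of_notMem (ψ := curry g) hz)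
    -- the two integrands
    set G₁ : ℝ × EuclideanSpace ℝ (Fin 3) → ℝ := fun z => ⟪w z.1 z.2, gradient (curry g z.1) z.2⟫ with hG₁
    set G₂ : ℝ × EuclideanSpace ℝ (Fin 3) → ℝ := fun z => g z * d z with hG₂
    have cG₁ : ContinuousOn G₁ U := cw.inner hθ.continuous_slice_gradient.continuousOn
    have cG₂ : ContinuousOn G₂ U := hg.continuous.continuousOn.mul cd
    have hG₁0 : ∀ z ∉ K, G₁ z = 0 := fun z hz => by
      simp only [hG₁, hgr0 z hz, inner_zero_right]
    have hG₂0 : ∀ z ∉ K, G₂ z = 0 := fun z hz => by simp only [hG₂, hg0 z hz, zero_mul]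
    obtain ⟨-, -, -, e1⟩ := slab_integrable_of_continuousOn hK hKU cG₁ hG₁0
    obtain ⟨-, -, -, e2⟩ := slab_integrable_of_continuousOn hK hKU cG₂ hG₂0
    -- slicewise integration by parts
    have key : ∀ s, ∫ y, G₂ (s, y) = -∫ y, G₁ (s, y) := by
      intro s
      by_cases hs : s ∈ Ioi (0 : ℝ)
      · have hws : ContDiff ℝ 1 (w s) := contDiff_slice_of_contDiffOn hw1 hs
        have hθs : ContDiff ℝ 1 (curry g s) :=
          (hθ.contDiff_slice s).of_le (by exact_mod_cast le_top)
        have := integral_mul_divergence_add_eq_zero_left hθs hws (hθ.hasCompactSupport_slice s)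
        have e : ∫ y, G₂ (s, y) = ∫ y, curry g s y * VectorCalculus.divergence (w s) y := rfl
        have e' : ∫ y, G₁ (s, y) = ∫ y, ⟪w s y, gradient (curry g s) y⟫ := rfl
        rw [e, e']
        linarith
      · have h1 : ∫ y, G₂ (s, y) = 0 :=
          integral_eq_zero_of_ae (Eventually.of_forall fun y => hG₂0 (s, y) fun hz => hs (hKU hz).1)
        have h2 : ∫ y, G₁ (s, y) = 0 :=
          integral_eq_zero_of_ae (Eventually.of_forall fun y => hG₁0 (s, y) fun hz => hs (hKU hz).1)
        rw [h1, h2, neg_zero]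
    have hfull : ∫ z, g z • d z = ∫ z in U, G₂ z := by
      rw [setIntegral_eq_integral_of_forall_compl_eq_zero fun z hz => hG₂0 z fun hK' => hz (hKU hK')]
      rfl
    rw [hfull, e2, integral_congr_ae (Eventually.of_forall key), integral_neg, ← e1]
    change -(∫ z in U, ⟪w z.1 z.2, gradient (curry g z.1) z.2⟫) = 0
    rw [h0, neg_zero]
  -- upgrade to every point of `U` by continuity
  have hEq : EqOn d 0 U :=
    Measure.eqOn_open_of_ae_eq ((ae_restrict_iff' hU.measurableSet).2 hae) hU cd
      continuousOn_const
  exact hEq (⟨ht, mem_univ x⟩ : (t, x) ∈ U)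

/-- The slices `v_ε(t)`, `t > 0`, are weakly divergence free. [folklore] -/
theorem IsMollifiedApproximant.isWeaklyDivFree_slice (h : IsMollifiedApproximant c ε η v₀ w ϖ)
    {t : ℝ} (ht : 0 < t) : IsWeaklyDivFree (w t) :=
  VectorCalculus.IsDivFree.isWeaklyDivFree_holds (fun x => h.divergence_eq_zero ht x)
    ((h.contDiff_slice ht).of_le (by exact_mod_cast le_top))

/-- For a member of the class with `ε > 0` and a `C_c^∞` mollifier, the drift slices
`η_{ε√t} * v_ε(t)`, `t > 0`, are smooth. [folklore] -/
theorem IsMollifiedApproximant.contDiff_mollifiedDrift_slice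
    (h : IsMollifiedApproximant c ε η v₀ w ϖ) (hη : ContDiff ℝ ∞ η) (hηc : HasCompactSupport η)
    (hε : 0 < ε) {t : ℝ} (ht : 0 < t) : ContDiff ℝ ∞ (mollifiedDrift η ε w t) :=
  BradshawTsai2019.contDiff_mollifiedDrift_slice hη hηc (mul_pos hε (Real.sqrt_pos.2 ht)).ne'
    (h.contDiff_slice ht).continuous.locallyIntegrable

/-- For a member of the class with `ε > 0` and a `C_c^∞` mollifier, the drift slices are
divergence free: `div (η_{ε√t} * v_ε)(t) = 0` on `ℝ³`, `t > 0`. [cite: BradshawTsai2019, (3.7)] -/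
theorem IsMollifiedApproximant.divergence_mollifiedDrift_slice
    (h : IsMollifiedApproximant c ε η v₀ w ϖ) (hη : ContDiff ℝ ∞ η) (hηc : HasCompactSupport η)
    (hε : 0 < ε) {t : ℝ} (ht : 0 < t) (x : (EuclideanSpace ℝ (Fin 3))) :
    VectorCalculus.divergence (mollifiedDrift η ε w t) x = 0 :=
  BradshawTsai2019.divergence_mollifiedDrift_slice hη hηc (mul_pos hε (Real.sqrt_pos.2 ht)).ne'
    (h.contDiff_slice ht).continuous.locallyIntegrable (h.isWeaklyDivFree_slice ht) x

/-- For a member of the class with `ε > 0` and a continuous compactly supported mollifier, the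
drift `η_{ε√t} * v_ε` is jointly continuous on the slab `(0,∞) × ℝ³`. [folklore] -/
theorem IsMollifiedApproximant.continuousOn_mollifiedDrift
    (h : IsMollifiedApproximant c ε η v₀ w ϖ) (hη : Continuous η) (hηc : HasCompactSupport η)
    (hε : 0 < ε) :
    ContinuousOn (uncurry (mollifiedDrift η ε w)) (Ioi (0 : ℝ) ×ˢ (univ : Set (EuclideanSpace ℝ (Fin 3)))) :=
  BradshawTsai2019.continuousOn_mollifiedDrift hη hηc hε h.smooth.continuousOn

/-- **The local energy equality (3.7) for a mollified approximant, test-function form**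
(Bradshaw–Tsai 2019, p. 8: "Note that `v_ε` satisfies the local energy equality, i.e.,
`∫|v_ε|²φ(t) dx + 2∫₀ᵗ∫|∇v_ε|²φ = ∫|v₀|²φ dx + ∫₀ᵗ∫|v_ε|²(∂ₛφ + Δφ) + ∫₀ᵗ∫|v_ε|²((η_{ε√s} * v_ε)·∇φ)
+ ∫₀ᵗ∫2π_ε(v_ε·∇φ)`"). For a member `(v_ε, π_ε)` of the class with `ε > 0` and a `C_c^∞`
mollifier `η`, and every space–time test function `φ` on the open slab `(0,∞) × ℝ³`,
`2 ∫∫ φ |∇v_ε|² = ∫∫ |v_ε|²(∂ₜφ + Δφ) + ∫∫ |v_ε|² ⟪η_{ε√t} * v_ε, ∇φ⟫ + ∫∫ 2π_ε ⟪v_ε, ∇φ⟫`, all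
integrals over the slab (for such `φ` the time-boundary terms of (3.7) are absent). Proof: test
the distributional equation (3.5) against `ψ = φ v_ε`; `div v_ε = 0` turns the pressure term into
`∫∫ π_ε ⟪v_ε, ∇φ⟫`, the pairing in time turns `∫∫ ⟪v_ε, ∂ₜ(φ v_ε)⟫` into `½∫∫ |v_ε|² ∂ₜφ`, and on
each slice `∫ ⟪v, Δ(φv)⟫ = ½∫ Δφ|v|² − ∫ φ|∇v|²`, `∫ ⟪v, (b·∇)(φv)⟫ = ½∫ |v|² ⟪b, ∇φ⟫` for the
divergence-free drift `b = η_{ε√t} * v_ε`. [cite: BradshawTsai2019, §3 (3.7)] -/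
theorem IsMollifiedApproximant.local_energy_eq (h : IsMollifiedApproximant c ε η v₀ w ϖ)
    (hη : ContDiff ℝ ∞ η) (hηc : HasCompactSupport η) (hε : 0 < ε)
    {φ : ℝ → EuclideanSpace ℝ (Fin 3) → ℝ}
    (hφ : IsSpaceTimeTestOn (slab (EuclideanSpace ℝ (Fin 3)) (Ioi 0) isOpen_Ioi) φ) :
    2 * ∫ z in Ioi (0 : ℝ) ×ˢ (univ : Set (EuclideanSpace ℝ (Fin 3))),
        φ z.1 z.2 * frobeniusNormSq (fderiv ℝ (w z.1) z.2) =
      (∫ z in Ioi (0 : ℝ) ×ˢ (univ : Set (EuclideanSpace ℝ (Fin 3))),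
          ‖w z.1 z.2‖ ^ 2 * (timeDeriv φ z.1 z.2 + (Δ (φ z.1)) z.2)) +
        (∫ z in Ioi (0 : ℝ) ×ˢ (univ : Set (EuclideanSpace ℝ (Fin 3))),
          ‖w z.1 z.2‖ ^ 2 * ⟪mollifiedDrift η ε w z.1 z.2, gradient (φ z.1) z.2⟫) +
        ∫ z in Ioi (0 : ℝ) ×ˢ (univ : Set (EuclideanSpace ℝ (Fin 3))),
          2 * ϖ z.1 z.2 * ⟪w z.1 z.2, gradient (φ z.1) z.2⟫ := by
  -- the setting: the open slab `Q = (0,∞) × ℝ³`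
  have hQopen : IsOpen (Ioi (0 : ℝ) ×ˢ (univ : Set (EuclideanSpace ℝ (Fin 3)))) := isOpen_Ioi.prod isOpen_univ
  have hQmeas : MeasurableSet (Ioi (0 : ℝ) ×ˢ (univ : Set (EuclideanSpace ℝ (Fin 3)))) := hQopen.measurableSet
  have hslab : ((slab (EuclideanSpace ℝ (Fin 3)) (Ioi 0) isOpen_Ioi :
      Opens (ℝ × EuclideanSpace ℝ (Fin 3))) : Set (ℝ × EuclideanSpace ℝ (Fin 3))) =
      Ioi (0 : ℝ) ×ˢ (univ : Set (EuclideanSpace ℝ (Fin 3))) := coe_slab _ _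
  have hw1 : ContDiffOn ℝ 1 (uncurry w) (Ioi (0 : ℝ) ×ˢ (univ : Set (EuclideanSpace ℝ (Fin 3)))) :=
    h.smooth.of_le (by exact_mod_cast le_top)
  have cw : ContinuousOn (fun z : ℝ × EuclideanSpace ℝ (Fin 3) => w z.1 z.2)
      (Ioi (0 : ℝ) ×ˢ (univ : Set (EuclideanSpace ℝ (Fin 3)))) :=
    h.smooth.continuousOn
  have cDw : ContinuousOn (fun z : ℝ × EuclideanSpace ℝ (Fin 3) => fderiv ℝ (w z.1) z.2)
      (Ioi (0 : ℝ) ×ˢ (univ : Set (EuclideanSpace ℝ (Fin 3)))) :=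
    continuousOn_fderiv_slice_of_contDiffOn hw1 isOpen_Ioi.uniqueDiffOn
  have cb : ContinuousOn (fun z : ℝ × EuclideanSpace ℝ (Fin 3) => mollifiedDrift η ε w z.1 z.2)
      (Ioi (0 : ℝ) ×ˢ (univ : Set (EuclideanSpace ℝ (Fin 3)))) :=
    h.continuousOn_mollifiedDrift hη.continuous hηc hε
  -- the test field `ψ = φ w` and the momentum identity tested against it
  set ψ : ℝ → (EuclideanSpace ℝ (Fin 3)) → (EuclideanSpace ℝ (Fin 3)) := fun t x => φ t x • w t x with hψ_def
  have hψ : IsSpaceTimeTestOn (slab (EuclideanSpace ℝ (Fin 3)) (Ioi 0) isOpen_Ioi) ψ :=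
    isSpaceTimeTestOn_smul_of_contDiffOn hQopen (by rw [hslab]) hφ h.smooth
  have M0 := h.momentum ψ hψ
  -- supports
  set K : Set (ℝ × EuclideanSpace ℝ (Fin 3)) := tsupport (uncurry φ) with hK_def
  have hK : IsCompact K := hφ.hasCompactSupport
  have hKQ : K ⊆ Ioi (0 : ℝ) ×ˢ (univ : Set (EuclideanSpace ℝ (Fin 3))) := by rw [← hslab]; exact hφ.tsupport_subset
  have hψK : tsupport (uncurry ψ) ⊆ K := tsupport_smul_subset_left _ _
  have hφ0 : ∀ z ∉ K, φ z.1 z.2 = 0 := fun z hz =>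
    (image_eq_zero_of_notMem_tsupport hz : uncurry φ z = 0)
  have hgφ0 : ∀ z ∉ K, gradient (φ z.1) z.2 = 0 := fun z hz =>
    gradient_eq_zero_of_notMem_tsupport (notMem_tsupport_slice_of_notMem hz)
  have hΔφ0 : ∀ z ∉ K, (Δ (φ z.1)) z.2 = 0 := fun z hz =>
    laplacian_eq_zero_of_notMem_tsupport (notMem_tsupport_slice_of_notMem hz)
  have hTφ0 : ∀ z ∉ K, timeDeriv φ z.1 z.2 = 0 := fun z hz => timeDeriv_eq_zero_off_tsupport hz
  have hDψ0 : ∀ z ∉ K, fderiv ℝ (ψ z.1) z.2 = 0 := fun z hz =>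
    fderiv_of_notMem_tsupport ℝ (notMem_tsupport_slice_of_notMem fun h' => hz (hψK h'))
  have hΔψ0 : ∀ z ∉ K, (Δ (ψ z.1)) z.2 = 0 := fun z hz =>
    laplacian_eq_zero_of_notMem_tsupport (notMem_tsupport_slice_of_notMem fun h' => hz (hψK h'))
  have hdivψ0 : ∀ z ∉ K, VectorCalculus.divergence (ψ z.1) z.2 = 0 := fun z hz =>
    divergence_eq_zero_of_notMem_tsupport (notMem_tsupport_slice_of_notMem fun h' => hz (hψK h'))
  have hTψ0 : ∀ z ∉ K, timeDeriv ψ z.1 z.2 = 0 := fun z hz =>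
    timeDeriv_eq_zero_off_tsupport fun h' => hz (hψK h')
  -- joint continuity of the test-function quantities
  have cφ : Continuous fun z : ℝ × EuclideanSpace ℝ (Fin 3) => φ z.1 z.2 := hφ.contDiff.continuous
  have cTφ : Continuous fun z : ℝ × EuclideanSpace ℝ (Fin 3) => timeDeriv φ z.1 z.2 := hφ.continuous_timeDeriv
  have cgφ : Continuous fun z : ℝ × EuclideanSpace ℝ (Fin 3) => gradient (φ z.1) z.2 := hφ.continuous_slice_gradient
  have cΔφ : Continuous fun z : ℝ × EuclideanSpace ℝ (Fin 3) => (Δ (φ z.1)) z.2 := hφ.continuous_laplacian_slice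
  have cTψ : Continuous fun z : ℝ × EuclideanSpace ℝ (Fin 3) => timeDeriv ψ z.1 z.2 := hψ.continuous_timeDeriv
  have cDψ : Continuous fun z : ℝ × EuclideanSpace ℝ (Fin 3) => fderiv ℝ (ψ z.1) z.2 := hψ.continuous_fderiv_slice
  have cΔψ : Continuous fun z : ℝ × EuclideanSpace ℝ (Fin 3) => (Δ (ψ z.1)) z.2 := hψ.continuous_laplacian_slice
  have cdivψ : Continuous fun z : ℝ × EuclideanSpace ℝ (Fin 3) => VectorCalculus.divergence (ψ z.1) z.2 :=
    hψ.continuous_divergence_slice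
  -- the integrands
  set T₁ : ℝ × EuclideanSpace ℝ (Fin 3) → ℝ := fun z => ⟪w z.1 z.2, timeDeriv ψ z.1 z.2⟫ with hT₁
  set T₂ : ℝ × EuclideanSpace ℝ (Fin 3) → ℝ := fun z =>
    ⟪w z.1 z.2, convect (mollifiedDrift η ε w z.1) (ψ z.1) z.2⟫ with hT₂
  set T₃ : ℝ × EuclideanSpace ℝ (Fin 3) → ℝ := fun z => ⟪w z.1 z.2, (Δ (ψ z.1)) z.2⟫ with hT₃
  set Tc : ℝ × EuclideanSpace ℝ (Fin 3) → ℝ := fun z => T₁ z + T₂ z + T₃ z with hTc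
  set P : ℝ × EuclideanSpace ℝ (Fin 3) → ℝ := fun z => ϖ z.1 z.2 * VectorCalculus.divergence (ψ z.1) z.2 with hP
  set P' : ℝ × EuclideanSpace ℝ (Fin 3) → ℝ := fun z => ϖ z.1 z.2 * ⟪w z.1 z.2, gradient (φ z.1) z.2⟫ with hP'
  set A : ℝ × EuclideanSpace ℝ (Fin 3) → ℝ := fun z => timeDeriv φ z.1 z.2 * ‖w z.1 z.2‖ ^ 2 with hA
  set Bq : ℝ × EuclideanSpace ℝ (Fin 3) → ℝ := fun z =>
    ‖w z.1 z.2‖ ^ 2 * ⟪mollifiedDrift η ε w z.1 z.2, gradient (φ z.1) z.2⟫ with hBq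
  set C : ℝ × EuclideanSpace ℝ (Fin 3) → ℝ := fun z => (Δ (φ z.1)) z.2 * ‖w z.1 z.2‖ ^ 2 with hC
  set D : ℝ × EuclideanSpace ℝ (Fin 3) → ℝ := fun z => φ z.1 z.2 * frobeniusNormSq (fderiv ℝ (w z.1) z.2) with hD
  -- continuity on the slab and vanishing off `K`
  have cT₁ : ContinuousOn T₁ (Ioi (0 : ℝ) ×ˢ (univ : Set (EuclideanSpace ℝ (Fin 3)))) := cw.inner cTψ.continuousOn
  have cT₂ : ContinuousOn T₂ (Ioi (0 : ℝ) ×ˢ (univ : Set (EuclideanSpace ℝ (Fin 3)))) :=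
    cw.inner (cDψ.continuousOn.clm_apply cb)
  have cT₃ : ContinuousOn T₃ (Ioi (0 : ℝ) ×ˢ (univ : Set (EuclideanSpace ℝ (Fin 3)))) := cw.inner cΔψ.continuousOn
  have cTc : ContinuousOn Tc (Ioi (0 : ℝ) ×ˢ (univ : Set (EuclideanSpace ℝ (Fin 3)))) := (cT₁.add cT₂).add cT₃
  have cA : ContinuousOn A (Ioi (0 : ℝ) ×ˢ (univ : Set (EuclideanSpace ℝ (Fin 3)))) :=
    cTφ.continuousOn.mul (cw.norm.pow 2)
  have cBq : ContinuousOn Bq (Ioi (0 : ℝ) ×ˢ (univ : Set (EuclideanSpace ℝ (Fin 3)))) :=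
    (cw.norm.pow 2).mul (cb.inner cgφ.continuousOn)
  have cC : ContinuousOn C (Ioi (0 : ℝ) ×ˢ (univ : Set (EuclideanSpace ℝ (Fin 3)))) :=
    cΔφ.continuousOn.mul (cw.norm.pow 2)
  have cD : ContinuousOn D (Ioi (0 : ℝ) ×ˢ (univ : Set (EuclideanSpace ℝ (Fin 3)))) :=
    cφ.continuousOn.mul (LerayHopfProofs.continuous_frobeniusNormSq.comp_continuousOn cDw)
  have hT₁0 : ∀ z ∉ K, T₁ z = 0 := fun z hz => by simp only [hT₁, hTψ0 z hz, inner_zero_right]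
  have hT₂0 : ∀ z ∉ K, T₂ z = 0 := fun z hz => by simp [hT₂, convect, hDψ0 z hz]
  have hT₃0 : ∀ z ∉ K, T₃ z = 0 := fun z hz => by simp only [hT₃, hΔψ0 z hz, inner_zero_right]
  have hTc0 : ∀ z ∉ K, Tc z = 0 := fun z hz => by
    simp only [hTc, hT₁0 z hz, hT₂0 z hz, hT₃0 z hz, add_zero]
  have hP0 : ∀ z ∉ K, P z = 0 := fun z hz => by simp only [hP, hdivψ0 z hz, mul_zero]
  have hA0 : ∀ z ∉ K, A z = 0 := fun z hz => by simp only [hA, hTφ0 z hz, zero_mul]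
  have hBq0 : ∀ z ∉ K, Bq z = 0 := fun z hz => by
    simp only [hBq, hgφ0 z hz, inner_zero_right, mul_zero]
  have hC0 : ∀ z ∉ K, C z = 0 := fun z hz => by simp only [hC, hΔφ0 z hz, zero_mul]
  have hD0 : ∀ z ∉ K, D z = 0 := fun z hz => by simp only [hD, hφ0 z hz, zero_mul]
  -- slab bookkeeping for the continuous integrands
  obtain ⟨sT₁, tT₁, -, -⟩ := slab_integrable_of_continuousOn hK hKQ cT₁ hT₁0
  obtain ⟨sT₂, tT₂, -, -⟩ := slab_integrable_of_continuousOn hK hKQ cT₂ hT₂0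
  obtain ⟨sT₃, tT₃, -, -⟩ := slab_integrable_of_continuousOn hK hKQ cT₃ hT₃0
  obtain ⟨-, -, iTc, eTc⟩ := slab_integrable_of_continuousOn hK hKQ cTc hTc0
  obtain ⟨sA, tA, iA, eA⟩ := slab_integrable_of_continuousOn hK hKQ cA hA0
  obtain ⟨-, -, -, eBq⟩ := slab_integrable_of_continuousOn hK hKQ cBq hBq0
  obtain ⟨-, tC, iC, eC⟩ := slab_integrable_of_continuousOn hK hKQ cC hC0
  obtain ⟨-, tD, -, eD⟩ := slab_integrable_of_continuousOn hK hKQ cD hD0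
  -- the pressure integrand is integrable on the slab and equals `P'` there
  have iP : IntegrableOn P (Ioi (0 : ℝ) ×ˢ (univ : Set (EuclideanSpace ℝ (Fin 3)))) volume := by
    have iK : IntegrableOn (uncurry ϖ) K volume :=
      h.locallyIntegrableOn_pressure.integrableOn_compact_subset hKQ hK
    have iPK : IntegrableOn P K volume := iK.mul_continuousOn cdivψ.continuousOn hK
    exact iPK.of_forall_sdiff_eq_zero hQmeas fun z hz => hP0 z hz.2
  have ePP' : ∫ z in Ioi (0 : ℝ) ×ˢ (univ : Set (EuclideanSpace ℝ (Fin 3))), P z =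
      ∫ z in Ioi (0 : ℝ) ×ˢ (univ : Set (EuclideanSpace ℝ (Fin 3))), P' z := by
    refine setIntegral_congr_fun hQmeas fun z hz => ?_
    have hz1 : 0 < z.1 := hz.1
    have hdφ : DifferentiableAt ℝ (φ z.1) z.2 :=
      (hφ.contDiff_slice z.1).differentiable (by simp) z.2
    have hdw : DifferentiableAt ℝ (w z.1) z.2 :=
      (h.contDiff_slice hz1).differentiable (by simp) z.2
    simp only [hP, hP']
    rw [show ψ z.1 = fun y => φ z.1 y • w z.1 y from rfl, divergence_smul_apply hdφ hdw,
      h.divergence_eq_zero hz1, mul_zero, zero_add]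
  -- the momentum identity, split
  have M : (∫ z in Ioi (0 : ℝ) ×ˢ (univ : Set (EuclideanSpace ℝ (Fin 3))), Tc z) +
      ∫ z in Ioi (0 : ℝ) ×ˢ (univ : Set (EuclideanSpace ℝ (Fin 3))), P z = 0 := by
    rw [← integral_add iTc iP]
    exact M0
  -- the pairing in time: `∫∫ ⟪w, ∂ₜψ⟫ = ½ ∫∫ ∂ₜφ |w|²`
  set a : ℝ → (EuclideanSpace ℝ (Fin 3)) → ℝ := fun s x => 2⁻¹ * (φ s x * ‖w s x‖ ^ 2) with ha_def
  set a' : ℝ → (EuclideanSpace ℝ (Fin 3)) → ℝ := fun s x => T₁ (s, x) - 2⁻¹ * A (s, x) with ha'_def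
  have hderiv : ∀ s ∈ Ioi (0 : ℝ), ∀ x, HasDerivAt (fun σ => a σ x) (a' s x) s := by
    intro s hs x
    have hd := hasDerivAt_timeLine_of_contDiffOn hw1 (isOpen_Ioi.mem_nhds hs) x
    have hφ' := hφ.hasDerivAt_time s x
    have hψ' : HasDerivAt (fun σ => ψ σ x)
        (φ s x • fderiv ℝ (uncurry w) (s, x) (1, 0) + timeDeriv φ s x • w s x) s := hφ'.smul hd
    have hTψ : timeDeriv ψ s x =
        φ s x • fderiv ℝ (uncurry w) (s, x) (1, 0) + timeDeriv φ s x • w s x := hψ'.deriv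
    have ha : HasDerivAt (fun σ => a σ x) (2⁻¹ * (timeDeriv φ s x * ‖w s x‖ ^ 2 +
        φ s x * (2 * ⟪w s x, fderiv ℝ (uncurry w) (s, x) (1, 0)⟫))) s :=
      (hφ'.mul hd.norm_sq).const_mul 2⁻¹
    refine ha.congr_deriv ?_
    simp only [ha'_def, hT₁, hA, hTψ, inner_add_right, real_inner_smul_right,
      real_inner_self_eq_norm_sq]
    ring
  have ha0 : ∀ z ∉ K, a z.1 z.2 = 0 := fun z hz => by
    simp only [ha_def, hφ0 z hz, zero_mul, mul_zero]
  have ha0' : ∀ z ∉ K, a' z.1 z.2 = 0 := fun z hz => by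
    obtain ⟨s, x⟩ := z
    simp only [ha'_def, hT₁0 _ hz, hA0 _ hz, mul_zero, sub_zero]
  have hcont : ContinuousOn (uncurry a') (Ioi (0 : ℝ) ×ˢ (univ : Set (EuclideanSpace ℝ (Fin 3)))) := by
    have : uncurry a' = fun z => T₁ z - 2⁻¹ * A z := by funext z; rfl
    rw [this]
    exact cT₁.sub (continuousOn_const.mul cA)
  have hpair : ∫ s, ∫ x, a' s x = 0 :=
    integral_integral_eq_zero_of_hasDerivAt_time isOpen_Ioi hK hKQ hderiv ha0 ha0' hcont
  have eTime : ∫ s, ∫ x, T₁ (s, x) = 2⁻¹ * ∫ s, ∫ x, A (s, x) := by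
    have hslice : ∀ s, ∫ x, a' s x = (∫ x, T₁ (s, x)) - 2⁻¹ * ∫ x, A (s, x) := fun s => by
      simp only [ha'_def]
      rw [integral_sub (sT₁ s) ((sA s).const_mul _), integral_const_mul]
    have h1 : ∫ s, ∫ x, a' s x = (∫ s, ∫ x, T₁ (s, x)) - 2⁻¹ * ∫ s, ∫ x, A (s, x) := by
      rw [integral_congr_ae (Eventually.of_forall hslice), integral_sub tT₁ (tA.const_mul _),
        integral_const_mul]
    rw [hpair] at h1
    linarith
  -- the drift term, slice by slice: `∫ ⟪w, (b·∇)(φw)⟫ = ½ ∫ |w|² ⟪b, ∇φ⟫`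
  have eDrift : ∫ s, ∫ x, T₂ (s, x) = 2⁻¹ * ∫ s, ∫ x, Bq (s, x) := by
    have key : ∀ s, ∫ x, T₂ (s, x) = 2⁻¹ * ∫ x, Bq (s, x) := by
      intro s
      by_cases hs : s ∈ Ioi (0 : ℝ)
      · have hs' : 0 < s := hs
        have hw1s : ContDiff ℝ 1 (w s) := contDiff_infty.1 (h.contDiff_slice hs') 1
        have hbs : ContDiff ℝ 1 (mollifiedDrift η ε w s) :=
          contDiff_infty.1 (h.contDiff_mollifiedDrift_slice hη hηc hε hs') 1
        have hφ1 : ContDiff ℝ 1 (φ s) := contDiff_infty.1 (hφ.contDiff_slice s) 1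
        have hid := integral_inner_convect_smul_self hw1s hbs
          (h.divergence_mollifiedDrift_slice hη hηc hε hs') hφ1 (hφ.hasCompactSupport_slice s)
        simp only [hT₂, hBq, hψ_def]
        exact hid
      · rw [integral_eq_zero_of_ae (Eventually.of_forall fun x =>
            hT₂0 (s, x) fun hz => hs (hKQ hz).1),
          integral_eq_zero_of_ae (Eventually.of_forall fun x =>
            hBq0 (s, x) fun hz => hs (hKQ hz).1), mul_zero]
    rw [integral_congr_ae (Eventually.of_forall key), integral_const_mul]
  -- the Laplacian term, slice by slice: `∫ ⟪w, Δ(φw)⟫ = ½ ∫ Δφ |w|² − ∫ φ |∇w|²`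
  have eLap : ∫ s, ∫ x, T₃ (s, x) = 2⁻¹ * (∫ s, ∫ x, C (s, x)) - ∫ s, ∫ x, D (s, x) := by
    have key : ∀ s, ∫ x, T₃ (s, x) = 2⁻¹ * (∫ x, C (s, x)) - ∫ x, D (s, x) := by
      intro s
      by_cases hs : s ∈ Ioi (0 : ℝ)
      · have hs' : 0 < s := hs
        have hw2s : ContDiff ℝ 2 (w s) := contDiff_infty.1 (h.contDiff_slice hs') 2
        have hφ2 : ContDiff ℝ 2 (φ s) := contDiff_infty.1 (hφ.contDiff_slice s) 2
        have hid := integral_inner_laplacian_smul_self hw2s hφ2 (hφ.hasCompactSupport_slice s)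
        simp only [hT₃, hC, hD, hψ_def]
        exact hid
      · rw [integral_eq_zero_of_ae (Eventually.of_forall fun x =>
            hT₃0 (s, x) fun hz => hs (hKQ hz).1),
          integral_eq_zero_of_ae (Eventually.of_forall fun x =>
            hC0 (s, x) fun hz => hs (hKQ hz).1),
          integral_eq_zero_of_ae (Eventually.of_forall fun x =>
            hD0 (s, x) fun hz => hs (hKQ hz).1)]
        ring
    rw [integral_congr_ae (Eventually.of_forall key), integral_sub (tC.const_mul _) tD,
      integral_const_mul]
  -- the sum of the three continuous terms
  have eTcSplit : ∫ s, ∫ x, Tc (s, x) =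
      (∫ s, ∫ x, T₁ (s, x)) + (∫ s, ∫ x, T₂ (s, x)) + ∫ s, ∫ x, T₃ (s, x) := by
    have hslice : ∀ s, ∫ x, Tc (s, x) =
        (∫ x, T₁ (s, x)) + (∫ x, T₂ (s, x)) + ∫ x, T₃ (s, x) := fun s => by
      simp only [hTc]
      rw [integral_add (f := fun x => T₁ (s, x) + T₂ (s, x)) (g := fun x => T₃ (s, x))
        ((sT₁ s).add (sT₂ s)) (sT₃ s), integral_add (sT₁ s) (sT₂ s)]
    rw [integral_congr_ae (Eventually.of_forall hslice),
      integral_add (f := fun s => (∫ x, T₁ (s, x)) + ∫ x, T₂ (s, x))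
        (g := fun s => ∫ x, T₃ (s, x)) (tT₁.add tT₂) tT₃, integral_add tT₁ tT₂]
  have hTcval : ∫ z in Ioi (0 : ℝ) ×ˢ (univ : Set (EuclideanSpace ℝ (Fin 3))), Tc z =
      2⁻¹ * (∫ s, ∫ x, A (s, x)) + 2⁻¹ * (∫ s, ∫ x, Bq (s, x)) +
        (2⁻¹ * (∫ s, ∫ x, C (s, x)) - ∫ s, ∫ x, D (s, x)) := by
    rw [eTc, eTcSplit, eTime, eDrift, eLap]
  -- the right-hand side in terms of `A`, `C`, `Bq`, `P'`
  have eRHS1 : ∫ z in Ioi (0 : ℝ) ×ˢ (univ : Set (EuclideanSpace ℝ (Fin 3))),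
      ‖w z.1 z.2‖ ^ 2 * (timeDeriv φ z.1 z.2 + (Δ (φ z.1)) z.2) =
      (∫ z in Ioi (0 : ℝ) ×ˢ (univ : Set (EuclideanSpace ℝ (Fin 3))), A z) +
        ∫ z in Ioi (0 : ℝ) ×ˢ (univ : Set (EuclideanSpace ℝ (Fin 3))), C z := by
    rw [← integral_add iA iC]
    refine integral_congr_ae (Eventually.of_forall fun z => ?_)
    simp only [hA, hC]
    ring
  have eRHS3 : ∫ z in Ioi (0 : ℝ) ×ˢ (univ : Set (EuclideanSpace ℝ (Fin 3))),
      2 * ϖ z.1 z.2 * ⟪w z.1 z.2, gradient (φ z.1) z.2⟫ =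
      2 * ∫ z in Ioi (0 : ℝ) ×ˢ (univ : Set (EuclideanSpace ℝ (Fin 3))), P' z := by
    rw [← integral_const_mul]
    refine integral_congr_ae (Eventually.of_forall fun z => ?_)
    simp only [hP']
    ring
  rw [eRHS1, eRHS3, ← ePP', eA, eC, eBq, eD]
  linarith [M, hTcval]

end LocalEnergy

end BradshawTsai2019

end Literature.Analysis.FluidPDE

end
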